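import Literature.Analysis.FluidPDE.BoundedMildPressureIdentification
import Literature.Analysis.FluidPDE.OseenBallAverageMomentum
import Literature.Analysis.FluidPDE.NSBoundedMildOseenRestart
import HarnessLib

/-!
# Bounded Oseen-mild solutions: momentum conservation at every centre, and the pressure is the
# Riesz pressure modulo constants (KNSS 2009 §4; Seregin 2014 §6.3)

Analysis/FluidPDE proofs file (all results proved; no definitions, no named facts). A bounded
field solving the Oseen integral equation `u(t) = e^{(t−s)Δ}u(s) − B¹_s(u,u)(t)`
(Koch–Nadirashvili–Seregin–Šverák 2009, §4 (i): mild bounded solutions) conserves momentum at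
spatial infinity at EVERY centre, `⨍_{B(c,ρ)} (u(t) − u(s)) → 0` (`ρ → ∞`) — the tree's
`tendsto_setAverage_heatExtension_sub` / `tendsto_setAverage_oseenDuhamel` at the origin,
transported to `c` by the translation covariance of the heat and Oseen kernels
(`tendsto_setAverage_sub_of_oseenMild`). Consequently (`BoundedMildPressureIdentification`) the
classical pressure of a bounded Oseen-mild classical solution with bounded quadratic source is
the Riesz pressure modulo constants: `p(t, ·) = pressurePotentialMod x₀ (u t) + C(t)`
(`pressure_eq_pressurePotentialMod_add_const_of_oseenMild`; Seregin 2014, Def 6.3 / Rem 6.4: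
mild bounded ancient solutions carry the `L∞(BMO)` pressure `p_{u⊗u}`, no drift `b′(t)·x`; the two
definitions of mildness — KNSS's integral equation and Seregin–Šverák's `p ∈ L∞(BMO)` — agree).

## References

* G. Koch, N. Nadirashvili, G. Seregin, V. Šverák, Acta Math. 203 (2009) = arXiv:0709.3599,
  §4 p. 8. [KochNadirashviliSereginSverak2009]
* G. Seregin, *Lecture Notes on Regularity Theory for the Navier–Stokes Equations* (2014), §6.3
  Def 6.3, Rem 6.4. [Seregin2014]
-/

noncomputable section

open MeasureTheory Set Filter Metric Function
open scoped Topology InnerProductSpace RealInnerProductSpace ENNReal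

namespace Literature.Analysis.FluidPDE

namespace PressureNormalisation

/-! ### Translation covariance (private copies of three-line tree facts) -/

/-- `e^{τΔ}(g(· + c))(x) = e^{τΔ}g(x + c)`. [folklore] -/
private theorem heatExtension_comp_add_right_aux
    (g : EuclideanSpace ℝ (Fin 3) → EuclideanSpace ℝ (Fin 3)) (c : EuclideanSpace ℝ (Fin 3)) (τ : ℝ)
    (x : EuclideanSpace ℝ (Fin 3)) :
    UnboundedOperators.heatExtension (fun w => g (w + c)) τ x =
      UnboundedOperators.heatExtension g τ (x + c) := by
  rw [UnboundedOperators.heatExtension_apply, UnboundedOperators.heatExtension_apply]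
  refine integral_congr_ae (Eventually.of_forall fun v => ?_)
  simp only [add_sub_right_comm x c v]

/-- `B^ν_s(u(·,· + c), v(·,· + c))(t)(x) = B^ν_s(u,v)(t)(x + c)`. [folklore] -/
private theorem oseenDuhamel_comp_add_right_aux (ν s : ℝ)
    (u v : ℝ → EuclideanSpace ℝ (Fin 3) → EuclideanSpace ℝ (Fin 3)) (c : EuclideanSpace ℝ (Fin 3))
    (t : ℝ) (x : EuclideanSpace ℝ (Fin 3)) :
    oseenDuhamel ν s (fun τ y => u τ (y + c)) (fun τ y => v τ (y + c)) t x =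
      oseenDuhamel ν s u v t (x + c) := by
  simp only [oseenDuhamel_apply]
  refine setIntegral_congr_fun measurableSet_Ioo fun τ _ => ?_
  rw [← integral_add_right_eq_self (fun y => oseenKernel (ν * (t - τ)) (x + c - y) (u τ y) (v τ y)) c]
  refine integral_congr_ae (Eventually.of_forall fun y => ?_)
  simp only [add_sub_add_right_eq_sub]

/-! ### Momentum conservation at every centre -/

/-- **Bounded Oseen-mild fields conserve momentum at spatial infinity, at every centre**: if
`u` is jointly measurable, bounded by `N` on `[s, t] × ℝ³` (`s < t`), and
`u(t) = e^{(t−s)Δ}u(s) − B¹_s(u,u)(t)`, then `⨍_{B(c,R)} (u(t) − u(s)) → 0` as `R → ∞` for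
every `c` (KNSS 2009, §4: `B` only involves spatial derivatives of `u ⊗ u`).
[cite: KochNadirashviliSereginSverak2009, §4 p. 8] -/
theorem tendsto_setAverage_sub_of_oseenMild
    {u : ℝ → EuclideanSpace ℝ (Fin 3) → EuclideanSpace ℝ (Fin 3)} (hum : Measurable (uncurry u))
    {s t N : ℝ} (hst : s < t) (hN : ∀ σ ∈ Icc s t, ∀ y, ‖u σ y‖ ≤ N)
    (hmild : ∀ x, u t x = UnboundedOperators.heatExtension (u s) (t - s) x - oseenDuhamel 1 s u u t x)
    (c : EuclideanSpace ℝ (Fin 3)) :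
    Tendsto (fun R : ℝ => ⨍ y in ball c R, (u t y - u s y)) atTop (𝓝 0) := by
  have hd : Module.finrank ℝ (EuclideanSpace ℝ (Fin 3)) = 3 := finrank_euclideanSpace_fin
  -- the translated field
  set V : ℝ → EuclideanSpace ℝ (Fin 3) → EuclideanSpace ℝ (Fin 3) := fun τ y => u τ (y + c) with hV
  have hVm : Measurable (uncurry V) := by
    have : uncurry V = uncurry u ∘ fun p : ℝ × EuclideanSpace ℝ (Fin 3) => (p.1, p.2 + c) := by
      funext p; rfl
    rw [this]
    exact hum.comp (measurable_fst.prodMk (measurable_snd.add_const c))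
  have hVN : ∀ σ ∈ Icc s t, ∀ y, ‖V σ y‖ ≤ N := fun σ hσ y => hN σ hσ (y + c)
  have hVs : Measurable (V s) := hVm.comp measurable_prodMk_left
  have hNs : ∀ y, ‖V s y‖ ≤ N := hVN s (left_mem_Icc.2 hst.le)
  have hN0 : 0 ≤ N := (norm_nonneg _).trans (hNs 0)
  have hNo : ∀ τ ∈ Ioo s t, ∀ y, ‖V τ y‖ ≤ N := fun τ hτ y => hVN τ (Ioo_subset_Icc_self hτ) y
  obtain ⟨C, -, hC⟩ := exists_norm_oseenDuhamel_bounded_le (E := EuclideanSpace ℝ (Fin 3))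
  have h := (tendsto_setAverage_heatExtension_sub hd hVs hNs (sub_pos.2 hst)).sub
    (tendsto_setAverage_oseenDuhamel hd hVm hst hVN)
  rw [sub_zero] at h
  -- identify the averaged function with `(u t − u s)(· + c)`
  have hAi : ∀ R, Integrable (fun x => UnboundedOperators.heatExtension (V s) (t - s) x - V s x)
      ((volume : Measure (EuclideanSpace ℝ (Fin 3))).restrict (ball 0 R)) := fun R =>
    Measure.integrableOn_of_bounded (M := N + N) measure_ball_lt_top.ne
      ((aestronglyMeasurable_heatExtension_of_aestronglyMeasurable hVs.aestronglyMeasurable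
        _).sub hVs.aestronglyMeasurable)
      (ae_of_all _ fun x => (norm_sub_le _ _).trans (add_le_add
        (UnboundedOperators.norm_heatExtension_le hNs (sub_pos.2 hst) x) (hNs x)))
  have hDi : ∀ R, Integrable (oseenDuhamel 1 s V V t)
      ((volume : Measure (EuclideanSpace ℝ (Fin 3))).restrict (ball 0 R)) := fun R =>
    Measure.integrableOn_of_bounded measure_ball_lt_top.ne
      (aestronglyMeasurable_oseenDuhamel one_pos hVm.aestronglyMeasurable hVm.aestronglyMeasurable
        hN0 hNo hNo hst le_rfl)
      (ae_of_all _ fun x => hC one_pos hst hN0 hNo hNo x)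
  have hpt : ∀ x, UnboundedOperators.heatExtension (V s) (t - s) x - V s x - oseenDuhamel 1 s V V t x =
      u t (x + c) - u s (x + c) := fun x => by
    rw [hV]
    simp only
    rw [heatExtension_comp_add_right_aux, oseenDuhamel_comp_add_right_aux, hmild (x + c)]
    abel
  have h' : Tendsto (fun R : ℝ => ⨍ x in ball (0 : EuclideanSpace ℝ (Fin 3)) R,
      (u t (x + c) - u s (x + c))) atTop (𝓝 0) := by
    refine h.congr fun R => ?_
    rw [setAverage_eq, setAverage_eq, setAverage_eq, ← smul_sub, ← integral_sub (hAi R) (hDi R)]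
    congr 1
    exact integral_congr_ae (Eventually.of_forall fun x => hpt x)
  -- translate the ball
  refine h'.congr fun R => ?_
  have hpre : (fun x : EuclideanSpace ℝ (Fin 3) => x + c) ⁻¹' ball c R = ball 0 R := by
    ext x; simp [mem_ball, dist_eq_norm]
  have hint := (measurePreserving_add_right (volume : Measure (EuclideanSpace ℝ (Fin 3))) c).setIntegral_preimage_emb
    (measurableEmbedding_addRight c) (fun y => u t y - u s y) (ball c R)
  rw [hpre] at hint
  rw [setAverage_eq, setAverage_eq, hint, Measure.addHaar_real_ball_center volume c R]

/-! ### The pressure of a bounded Oseen-mild classical solution -/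

variable {u : ℝ → EuclideanSpace ℝ (Fin 3) → EuclideanSpace ℝ (Fin 3)}
  {p : ℝ → EuclideanSpace ℝ (Fin 3) → ℝ}

/-- **The pressure of a bounded Oseen-mild classical solution is the Riesz pressure modulo
constants** (KNSS 2009 §4; Seregin 2014 Def 6.3 / Rem 6.4 — the equivalence of the two notions
of mild bounded solution). Let `(u, p)` be a classical solution of the unforced Navier–Stokes
system (`ν = 1`) on `(t₁, t₂)` with `‖u‖ ≤ N`, `|∂ᵢ∂ⱼ(uᵢuⱼ)| ≤ N_G`, solving the Oseen integral
equation between any two times of the window. Then for every `t ∈ (t₁, t₂)` and base point `x₀`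
there is `C` with `p(t, x) = pressurePotentialMod x₀ (u t) x + C` for all `x`.
[cite: Seregin2014, §6.3 Def 6.3 and Rem 6.4; KochNadirashviliSereginSverak2009, §4 p. 8] -/
theorem pressure_eq_pressurePotentialMod_add_const_of_oseenMild {t₁ t₂ : ℝ}
    (h : IsClassicalNSSolutionOn (Ioo t₁ t₂) 1 0 u p) {N NG : ℝ}
    (hN : ∀ t ∈ Ioo t₁ t₂, ∀ x, ‖u t x‖ ≤ N)
    (hG : ∀ t ∈ Ioo t₁ t₂, ∀ x, |pressureSource (u t) x| ≤ NG)
    (hmild : ∀ s ∈ Ioo t₁ t₂, ∀ t ∈ Ioo t₁ t₂, s < t → ∀ x,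
      u t x = UnboundedOperators.heatExtension (u s) (t - s) x - oseenDuhamel 1 s u u t x)
    (x₀ : EuclideanSpace ℝ (Fin 3)) {t : ℝ} (ht : t ∈ Ioo t₁ t₂) :
    ∃ C : ℝ, ∀ x, p t x = pressurePotentialMod x₀ (u t) x + C := by
  refine pressure_eq_pressurePotentialMod_add_const zero_le_one h hN hG ?_ x₀ ht
  -- momentum conservation between any two times of the window
  have hcont : ContinuousOn (uncurry u) (Ioo t₁ t₂ ×ˢ univ) := h.smooth_velocity.continuousOn
  have key : ∀ s₁ ∈ Ioo t₁ t₂, ∀ s₂ ∈ Ioo t₁ t₂, s₁ < s₂ → ∀ c : EuclideanSpace ℝ (Fin 3),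
      Tendsto (fun ρ : ℝ => ⨍ y in ball c ρ, (u s₂ y - u s₁ y)) atTop (𝓝 0) := by
    intro s₁ hs₁ s₂ hs₂ hlt c
    -- clamp time into `[s₁, s₂]` to get a globally measurable field
    set V : ℝ → EuclideanSpace ℝ (Fin 3) → EuclideanSpace ℝ (Fin 3) :=
      fun τ => u (max s₁ (min s₂ τ)) with hV
    have hcl : ∀ τ, max s₁ (min s₂ τ) ∈ Icc s₁ s₂ := fun τ =>
      ⟨le_max_left _ _, max_le hlt.le (min_le_left _ _)⟩
    have hIcc : Icc s₁ s₂ ⊆ Ioo t₁ t₂ := fun τ hτ => ⟨hs₁.1.trans_le hτ.1, hτ.2.trans_lt hs₂.2⟩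
    have hVc : Continuous (uncurry V) := by
      have e : uncurry V = uncurry u ∘ fun q : ℝ × EuclideanSpace ℝ (Fin 3) => (max s₁ (min s₂ q.1), q.2) := by
        funext q; rfl
      rw [e]
      refine hcont.comp_continuous ((continuous_const.max (continuous_const.min continuous_fst)).prodMk
        continuous_snd) fun q => ⟨hIcc (hcl q.1), mem_univ _⟩
    have hVeq : ∀ τ ∈ Icc s₁ s₂, V τ = u τ := fun τ hτ => by
      rw [hV]; simp only [min_eq_right hτ.2, max_eq_right hτ.1]
    have hVN : ∀ σ ∈ Icc s₁ s₂, ∀ y, ‖V σ y‖ ≤ N := fun σ hσ y => by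
      rw [hVeq σ hσ]; exact hN σ (hIcc hσ) y
    have hV1 : V s₁ = u s₁ := hVeq s₁ (left_mem_Icc.2 hlt.le)
    have hV2 : V s₂ = u s₂ := hVeq s₂ (right_mem_Icc.2 hlt.le)
    have hmildV : ∀ x, V s₂ x = UnboundedOperators.heatExtension (V s₁) (s₂ - s₁) x -
        oseenDuhamel 1 s₁ V V s₂ x := fun x => by
      have e : oseenDuhamel 1 s₁ V V s₂ x = oseenDuhamel 1 s₁ u u s₂ x := by
        simp only [oseenDuhamel_apply]
        refine setIntegral_congr_fun measurableSet_Ioo fun τ hτ => ?_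
        simp only [hVeq τ (Ioo_subset_Icc_self hτ)]
      rw [e, hV1, hV2]
      exact hmild s₁ hs₁ s₂ hs₂ hlt x
    have := tendsto_setAverage_sub_of_oseenMild hVc.measurable hlt hVN hmildV c
    simpa only [hV1, hV2] using this
  intro s₁ hs₁ s₂ hs₂ c
  rcases lt_trichotomy s₁ s₂ with hlt | heq | hgt
  · exact key s₁ hs₁ s₂ hs₂ hlt c
  · subst heq; simp
  · have := (key s₂ hs₂ s₁ hs₁ hgt c).neg
    rw [neg_zero] at this
    refine this.congr fun ρ => ?_
    rw [← average_neg]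
    exact integral_congr_ae (Eventually.of_forall fun y => by simp)

end PressureNormalisation

end Literature.Analysis.FluidPDE

end
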